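import Mathlib
import HarnessLib
import Summits.NavierStokesRegularity.NavierStokesRegularity.Theorems.HalfSpaceWindowDoorCirculationCarryingRigidityRotHeadPV
import Summits.NavierStokesRegularity.NavierStokesRegularity.Theorems.PoloidalWindowDoorPoloidalWindowRigidityFlat
import Literature.Analysis.FluidPDE.VorticityCalculus

/-!
# Route `HalfSpaceWindowDoor`, crux `CirculationCarryingRigidity` (stmt-NavierStokesRegularity-25311) — line
# `rot_bernoulli`, VII: census row in Pineau–Vicol's vocabulary — closed-hemisphere door-class profiles of
# rotated-self-similar form (1.7) with `α ≤ 0` vanish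

LEAD ns-hsw-p1 g11 (cell pub-ns-dss).  The door-class form (`InDoorClass C v`, `SignE3 v` = sign on EVERY slice, as in the
route's statements) of `…RotHeadPV`: by the instantaneous rotated self-similarity of Pineau–Vicol's ansatz field
(`…RotHeadPV.hasDerivAt_pvAnsatz_neg_one`: `∂ₜ(pvAnsatz α U)(−1,x) = ½U + ½DU·x + α(e₃×U − DU(e₃×x))`) and the
slice-sign assembly `…RotHeadPV.eq_zero_of_pvAnsatz_sliceSign` (the sign is needed on the slice `t = −1` only):

* `eq_zero_of_pvAnsatz` — a closed-hemisphere door-class profile (`InDoorClass C v`, `⟪curl v, e₃⟫ ≥ 0`) which on the slab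
  has Pineau–Vicol's rotated-self-similar form `v = pvAnsatz α U` with a time-independent profile and `α ≤ 0` VANISHES;
  `hemisphereLiouvilleE3_of_pvAnsatz` (W6 restricted, hypotheses verbatim), `not_isBackwardSingularPoint_of_pvAnsatz`,
  `alpha_pos_of_pvAnsatz_ne_zero` (ENEMY FORM: a non-zero closed-hemisphere RSS door-class profile has `α > 0`).

WHAT THIS IS NOT: not a statement about Navier–Stokes regularity (Clay A); the door statements concern HYPOTHETICAL blow-up
profiles (KNSS ancient mild solutions); helper `--supports` 25311; the item stays OPEN at its research stub.
-/

noncomputable section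

-- the summit and its single sub-problem share the name (CONVENTIONS §1), as in every Theorems file
set_option linter.dupNamespace false

namespace Summit.NavierStokesRegularity.NavierStokesRegularity.Theorems.HalfSpaceWindowDoorCirculationCarryingRigidityRotHeadAnsatz

open Set Function Filter Topology InnerProductSpace
open scoped RealInnerProductSpace ContDiff
open Literature.Analysis Literature.Analysis.FluidPDE Literature.Analysis.FluidPDE.PineauVicol2026
open Summit.NavierStokesRegularity.NavierStokesRegularity.Theorems.HalfSpaceWindowDoorCirculationCarryingRigidityDefs
  (InDoorClass SignE3 e3 HemisphereLiouvilleE3)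
open Summit.NavierStokesRegularity.NavierStokesRegularity.Theorems.HalfSpaceWindowDoorCirculationCarryingRigidityRotHeadPV
  (eq_zero_of_pvAnsatz_sliceSign)
open Summit.NavierStokesRegularity.NavierStokesRegularity.Theorems.PoloidalWindowDoorPoloidalWindowRigidityFlat
  (not_backwardSingular_of_zero)

variable {C : ℝ} {v : ℝ → EuclideanSpace ℝ (Fin 3) → EuclideanSpace ℝ (Fin 3)}

/-- **Closed-hemisphere door-class profiles of rotated-self-similar form with `α ≤ 0` vanish.**  Let `v` be a door-class
profile with `⟪curl v(s), e₃⟫ ≥ 0` on the slab which has Pineau–Vicol's rotated-self-similar form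
`v(x,t) = (−t)^{−1/2} R(αs) U(R(−αs)x/√(−t))` (`pvAnsatz α U`, time-independent profile `U`) for `t < 0`, with `α ≤ 0`.
Then `v ≡ 0`.  (The profile is the slice `U = v(−1)`; the sign hypothesis of the door, imposed on every slice, is used on the
slice `t = −1` only, through `…RotHeadPV.eq_zero_of_pvAnsatz_sliceSign`.) -/
theorem eq_zero_of_pvAnsatz (hv : InDoorClass C v) (hsign : SignE3 v) {α : ℝ} (hα : α ≤ 0)
    {U : EuclideanSpace ℝ (Fin 3) → EuclideanSpace ℝ (Fin 3)}
    (hform : ∀ t < 0, ∀ x, v t x = pvAnsatz α (fun y _ => U y) t x) :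
    ∀ t < 0, ∀ x, v t x = 0 := by
  have h1 : (-1 : ℝ) < 0 := by norm_num
  have hsignU : ∀ y, 0 ≤ curl U y 2 := fun y => by
    have hUeq : U = v (-1) := funext fun z => by rw [hform (-1) h1 z, pvAnsatz_neg_one]
    have h := hsign (-1) h1 y
    rw [← hUeq] at h
    simpa [e3, EuclideanSpace.inner_single_right] using h
  exact eq_zero_of_pvAnsatz_sliceSign hv hα hsignU hform

/-- Hence such a profile is POLOIDAL along `e₃` (indeed zero). -/
theorem inner_curl_e3_eq_zero_of_pvAnsatz (hv : InDoorClass C v) (hsign : SignE3 v) {α : ℝ} (hα : α ≤ 0)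
    {U : EuclideanSpace ℝ (Fin 3) → EuclideanSpace ℝ (Fin 3)}
    (hform : ∀ t < 0, ∀ x, v t x = pvAnsatz α (fun y _ => U y) t x) :
    ∀ s < 0, ∀ y, ⟪curl (v s) y, e3⟫ = 0 := by
  intro s hs y
  have hz : v s = 0 := funext fun x => eq_zero_of_pvAnsatz hv hsign hα hform s hs x
  rw [hz, curl_zero]
  simp

/-- … and NOT backward singular at the apex. -/
theorem not_isBackwardSingularPoint_of_pvAnsatz (hv : InDoorClass C v) (hsign : SignE3 v) {α : ℝ} (hα : α ≤ 0)
    {U : EuclideanSpace ℝ (Fin 3) → EuclideanSpace ℝ (Fin 3)}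
    (hform : ∀ t < 0, ∀ x, v t x = pvAnsatz α (fun y _ => U y) t x) :
    ¬ IsBackwardSingularPoint v 0 :=
  not_backwardSingular_of_zero (eq_zero_of_pvAnsatz hv hsign hα hform)

/-- **W6 = `HemisphereLiouvilleE3` RESTRICTED TO THE COUNTER-ROTATING RSS STRATUM, in Pineau–Vicol's vocabulary** (the
hypotheses of `HemisphereLiouvilleE3` verbatim, plus `v = pvAnsatz α U` on the slab with `α ≤ 0`). -/
theorem hemisphereLiouvilleE3_of_pvAnsatz (C : ℝ) (v : ℝ → EuclideanSpace ℝ (Fin 3) → EuclideanSpace ℝ (Fin 3))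
    (hrate : HasTypeITimeDecay C v) (hcont : ContinuousOn (Function.uncurry v) (Set.Iio (0 : ℝ) ×ˢ Set.univ))
    (hmild : ∀ s t : ℝ, s < t → t < 0 → ∀ x,
      v t x = UnboundedOperators.heatExtension (v s) (t - s) x - oseenDuhamel 1 s v v t x)
    (hdiv : ∀ t < 0, VectorCalculus.IsDivFree (v t)) (hsign : ∀ s < 0, ∀ y, 0 ≤ ⟪curl (v s) y, e3⟫)
    {α : ℝ} (hα : α ≤ 0) {U : EuclideanSpace ℝ (Fin 3) → EuclideanSpace ℝ (Fin 3)}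
    (hform : ∀ t < 0, ∀ x, v t x = pvAnsatz α (fun y _ => U y) t x) :
    ∀ s < 0, ∀ y, ⟪curl (v s) y, e3⟫ = 0 :=
  inner_curl_e3_eq_zero_of_pvAnsatz ⟨hrate, hcont, hmild, hdiv⟩ hsign hα hform

/-- **ENEMY FORM.**  A closed-hemisphere door-class profile of rotated-self-similar form with a non-zero value CO-ROTATES
with its vertical vorticity: `α > 0`. -/
theorem alpha_pos_of_pvAnsatz_ne_zero (hv : InDoorClass C v) (hsign : SignE3 v) (hne : ∃ t < 0, ∃ x, v t x ≠ 0)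
    {α : ℝ} {U : EuclideanSpace ℝ (Fin 3) → EuclideanSpace ℝ (Fin 3)}
    (hform : ∀ t < 0, ∀ x, v t x = pvAnsatz α (fun y _ => U y) t x) : 0 < α := by
  by_contra hle
  push Not at hle
  obtain ⟨t, ht, x, hx⟩ := hne
  exact hx (eq_zero_of_pvAnsatz hv hsign hle hform t ht x)

end Summit.NavierStokesRegularity.NavierStokesRegularity.Theorems.HalfSpaceWindowDoorCirculationCarryingRigidityRotHeadAnsatz

end
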